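import Mathlib
import Summits.QuantumFields.YangMills.Theses.UniversalDetector
import Summits.QuantumFields.YangMills.Theorems.UniversalDetectorPlaneLimitExtraction
import Summits.QuantumFields.YangMills.Theorems.LangevinControlUVOSLegsFromFemtoAndGapStubLowerBump

/-!
# `UniversalDetector.BitOfPlaneTight` (item stmt-QuantumFields-24147) — proof

Glue of LINE g11-1 «blind detector» (planner ym-idea-8 g11) on route `UniversalDetector` (YangMills, rung R2a):
`PlaneTightScheme → SchemeEdgeBit` at the SAME unit `(r, a)`.

* EDGE from TIGHT6: the boundedness clause of TIGHT6 at the six diagonal orientation pairs `(q, q)`, read at the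
  axis points `m • e_k` of one femto annulus `η ≤ a(β) m ≤ 2η` (these points lie in the box once `a(β) L ≥ 2η`,
  which is folded into the threshold `Λ₅`).
* NONCONTACT_Ω from TIGHT6 ∧ NONCONTACT: given an admissible sequence `(β_k, L_k)` whose full normalised kernel
  converges to `K` on the mesh points of the off-hyperplane compacts `Ω_η = {η ≤ |a z_i| ∀ i, ‖a z‖ ≤ 1/η}`, the
  landed `Cruxes.UniversalDetectorPlaneTight.planeLimitExtraction` extracts a further subsequence converging on
  full annuli to a kernel `K̃` continuous off the origin; NONCONTACT gives `z₀ ≠ 0` with `K̃ z₀ ≠ 0`; continuity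
  gives a ball around `z₀` on which `|K̃| > 3|K̃ z₀|/4`; inside it a smaller ball all of whose points have every
  coordinate bounded away from `0`; for large `k` the mesh `a_k ℤ⁴ ∩ a_k·box` meets that ball (`a_k → 0`,
  `a_k L_k → ∞`) and there both convergences hold, so `|K − K̃| ≤ |K̃ z₀|/2` and `K ≠ 0` at a point with all
  coordinates non-zero.  (The witness is a mesh point: `K` need not be continuous.)

§1–§2 are Mathlib-only bookkeeping on `ℝ⁴` and on mesh points (coordinate/norm comparisons reused from
`Theorems.OSLegsFromFemtoAndGap.StubLower`); §3 is the abstract EDGE selection; §4 the abstract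
«bit off the hyperplanes»; §5 the item by name.

Glue only: the crux `SchemeEdgeBit` (24146), the residual `SkewAtEdgeScheme` (24149), the support `BlindDetector`
(24148), the rung `BalabanLadder.NT` and every summit statement remain open; the Yang–Mills mass gap is NOT proved
by this.  Refs: Glimm–Jaffe, *Quantum Physics* (1987) §6.1 (OS reconstruction context of the route) [folklore glue].
-/

set_option autoImplicit false

noncomputable section

open MeasureTheory Filter Topology
open Literature.MathematicalPhysics.QuantumFieldTheory Literature.MathematicalPhysics.QuantumLattice
  Literature.Probability.LatticeModels
open Summit.QuantumFields.YangMills.Cruxes.OSLegsFromFemtoAndGap.DlrCollarTransfer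
open Summit.QuantumFields.YangMills.Theorems.OSLegsFromFemtoAndGap.StubLower
  (abs_apply_le_norm norm_le_two_mul_of_forall_abs_le)

namespace Summit.QuantumFields.YangMills.Theorems.UniversalDetectorBitOfPlaneTight

/-! ## §1 Euclidean bookkeeping on `ℝ⁴` -/

/-- Near every point of `ℝ⁴` there is a point all of whose coordinates are non-zero (the coordinate hyperplanes
have dense complement). [folklore] -/
theorem exists_near_forall_apply_ne_zero (z₀ : EuclideanSpace ℝ (Fin 4)) {δ : ℝ} (hδ : 0 < δ) :
    ∃ w : EuclideanSpace ℝ (Fin 4), ‖w - z₀‖ < δ ∧ ∀ i, w i ≠ 0 := by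
  refine ⟨WithLp.toLp 2 (fun i => if z₀ i = 0 then δ / 4 else z₀ i), ?_, fun i => ?_⟩
  · have hc : ∀ i, |(WithLp.toLp 2 (fun i => if z₀ i = 0 then δ / 4 else z₀ i) - z₀) i| ≤ δ / 4 := by
      intro i
      simp only [PiLp.sub_apply]
      split_ifs with h
      · rw [h, sub_zero, abs_of_pos (by positivity)]
      · rw [sub_self, abs_zero]; positivity
    calc ‖WithLp.toLp 2 (fun i => if z₀ i = 0 then δ / 4 else z₀ i) - z₀‖ ≤ 2 * (δ / 4) :=
          norm_le_two_mul_of_forall_abs_le _ (by positivity) hc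
      _ < δ := by linarith
  · change (if z₀ i = 0 then δ / 4 else z₀ i) ≠ 0
    split_ifs with h
    · positivity
    · exact h

/-- A vector with all coordinates non-zero has its coordinates bounded away from zero. [folklore] -/
theorem exists_pos_forall_le_abs_apply (w : EuclideanSpace ℝ (Fin 4)) (hw : ∀ i, w i ≠ 0) :
    ∃ ρ : ℝ, 0 < ρ ∧ ∀ i, ρ ≤ |w i| := by
  refine ⟨Finset.univ.inf' Finset.univ_nonempty (fun i => |w i|), ?_,
    fun i => Finset.inf'_le _ (Finset.mem_univ i)⟩
  rw [Finset.lt_inf'_iff]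
  exact fun i _ => abs_pos.2 (hw i)

/-! ## §2 Mesh points -/

/-- Rounding a point of `ℝ⁴` down to the mesh `α ℤ⁴`: coordinatewise error at most `α`, and a bound on the lattice
coordinates. [folklore] -/
theorem exists_mesh_point {α : ℝ} (hα : 0 < α) (w : EuclideanSpace ℝ (Fin 4)) :
    ∃ z : Fin 4 → ℤ, (∀ i, |α * (z i : ℝ) - w i| ≤ α) ∧ ∀ i, |(z i : ℝ)| ≤ |w i| / α + 1 := by
  refine ⟨fun i => ⌊w i / α⌋, fun i => ?_, fun i => ?_⟩
  · have h1 : (⌊w i / α⌋ : ℝ) * α ≤ w i := (le_div_iff₀ hα).1 (Int.floor_le _)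
    have h2 : w i < ((⌊w i / α⌋ : ℝ) + 1) * α := (div_lt_iff₀ hα).1 (Int.lt_floor_add_one _)
    rw [abs_le]
    constructor <;> nlinarith
  · have h1 : (⌊w i / α⌋ : ℝ) ≤ w i / α := Int.floor_le _
    have h2 : w i / α < (⌊w i / α⌋ : ℝ) + 1 := Int.lt_floor_add_one _
    have h3 : w i / α ≤ |w i| / α := div_le_div_of_nonneg_right (le_abs_self _) hα.le
    have h4 : -(|w i| / α) ≤ w i / α := by
      rw [← neg_div]
      exact div_le_div_of_nonneg_right (neg_abs_le _) hα.le
    rw [abs_le]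
    constructor <;> linarith

/-- **Mesh meets ball, inside the box.**  If `α_k → 0⁺` and `α_k L_k → ∞`, then for every point `w` of `ℝ⁴` and
every `δ > 0`, eventually the scaled box `α_k · box L_k` contains a point within `δ` of `w`. [folklore] -/
theorem eventually_mesh_near (α : ℕ → ℝ) (L : ℕ → ℕ) (hα : ∀ k, 0 < α k) (hα0 : Tendsto α atTop (𝓝 0))
    (hαL : Tendsto (fun k => α k * L k) atTop atTop) (w : EuclideanSpace ℝ (Fin 4)) {δ : ℝ} (hδ : 0 < δ) :
    ∀ᶠ k in atTop, ∃ z ∈ box 4 (L k), ‖α k • siteToE z - w‖ < δ := by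
  have h1 : ∀ᶠ k in atTop, α k < δ / 2 := (tendsto_order.1 hα0).2 _ (by positivity)
  have h1' : ∀ᶠ k in atTop, α k < 1 := (tendsto_order.1 hα0).2 _ one_pos
  have h2 : ∀ᶠ k in atTop, ‖w‖ + 1 ≤ α k * L k := hαL.eventually_ge_atTop _
  filter_upwards [h1, h1', h2] with k hk1 hk1' hk2
  obtain ⟨z, hz1, hz2⟩ := exists_mesh_point (hα k) w
  refine ⟨z, ?_, ?_⟩
  · rw [mem_box]
    intro i
    have hwi : |w i| ≤ ‖w‖ := abs_apply_le_norm w i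
    have hαk := hα k
    have hzi : |(z i : ℝ)| ≤ (L k : ℝ) := by
      calc |(z i : ℝ)| ≤ |w i| / α k + 1 := hz2 i
        _ ≤ ‖w‖ / α k + 1 := by gcongr
        _ ≤ L k := by
          rw [div_add_one hαk.ne', div_le_iff₀ hαk]
          nlinarith
    obtain ⟨hlo, hhi⟩ := abs_le.1 hzi
    exact ⟨by exact_mod_cast hlo, by exact_mod_cast hhi⟩
  · have hc : ∀ i, |(α k • siteToE z - w) i| ≤ α k := fun i => by
      simpa [siteToE_apply, smul_eq_mul] using hz1 i
    calc ‖α k • siteToE z - w‖ ≤ 2 * α k := norm_le_two_mul_of_forall_abs_le _ (hα k).le hc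
      _ < δ := by linarith

/-! ## §3 EDGE from TIGHT6-boundedness -/

/-- **EDGE selection.**  A boundedness statement for the 36 plane kernels on the box off every `η`-ball (TIGHT6's
first clause) gives, for every `η ≤ 1`, one constant bounding the six diagonal kernels at the axis points of the
annulus `η ≤ a(β) m ≤ 2η`; the points lie in the box because the threshold `Λ₅` is raised by `2η`. [folklore] -/
theorem edge_of_bounded (a : ℝ → ℝ) (ha : ∀ β, 0 < a β)
    (ker6 : ℝ → ℕ → Fin 4 × Fin 4 → Fin 4 × Fin 4 → (Fin 4 → ℤ) → ℝ)
    (hB : ∀ p q : Fin 4 × Fin 4, p.1 < p.2 → q.1 < q.2 → ∀ η : ℝ, 0 < η → ∃ C β₅ Λ₅ : ℝ,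
      ∀ β : ℝ, β₅ ≤ β → ∀ L : ℕ, Λ₅ ≤ a β * L → ∀ z ∈ box 4 L, η ≤ ‖a β • siteToE z‖ →
        |ker6 β L p q z| ≤ C) :
    ∃ η₀ : ℝ, 0 < η₀ ∧ ∀ η : ℝ, 0 < η → η ≤ η₀ → ∃ C β₅ Λ₅ : ℝ, ∀ β : ℝ, β₅ ≤ β → ∀ L : ℕ,
      Λ₅ ≤ a β * L → ∀ q : Fin 4 × Fin 4, q.1 < q.2 → ∀ (k : Fin 4) (m : ℕ), η ≤ a β * m →
        a β * m ≤ 2 * η → |ker6 β L q q (Pi.single k (m : ℤ))| ≤ C := by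
  refine ⟨1, one_pos, fun η hη _ => ?_⟩
  choose C β₅ Λ₅ h using fun s : {q : Fin 4 × Fin 4 // q.1 < q.2} => hB s.1 s.1 s.2 s.2 η hη
  refine ⟨∑ s, |C s|, ∑ s, |β₅ s|, ∑ s, |Λ₅ s| + 2 * η, fun β hβ L hL q hq k m hm1 hm2 => ?_⟩
  have hβs : β₅ ⟨q, hq⟩ ≤ β :=
    (le_abs_self _).trans
      ((Finset.single_le_sum (fun s _ => abs_nonneg (β₅ s)) (Finset.mem_univ _)).trans hβ)
  have hΛsum : |Λ₅ ⟨q, hq⟩| ≤ ∑ s, |Λ₅ s| :=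
    Finset.single_le_sum (fun s _ => abs_nonneg (Λ₅ s)) (Finset.mem_univ _)
  have hLs : Λ₅ ⟨q, hq⟩ ≤ a β * L := by linarith [le_abs_self (Λ₅ ⟨q, hq⟩), hη.le]
  have hΛ0 : 0 ≤ ∑ s : {q : Fin 4 × Fin 4 // q.1 < q.2}, |Λ₅ s| :=
    Finset.sum_nonneg fun s _ => abs_nonneg _
  have haβ := ha β
  have hmL : (m : ℝ) ≤ L := by
    have : a β * m ≤ a β * L := by linarith
    exact le_of_mul_le_mul_left this haβ
  have hmL' : (m : ℤ) ≤ L := by exact_mod_cast hmL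
  have hbox : (Pi.single k (m : ℤ) : Fin 4 → ℤ) ∈ box 4 L := by
    rw [mem_box]
    intro j
    by_cases hj : j = k
    · subst hj; rw [Pi.single_eq_same]; omega
    · rw [Pi.single_eq_of_ne hj]; omega
  have hfar : η ≤ ‖a β • siteToE (Pi.single k (m : ℤ) : Fin 4 → ℤ)‖ := by
    calc η ≤ a β * m := hm1
      _ = |(a β • siteToE (Pi.single k (m : ℤ) : Fin 4 → ℤ)) k| := by
          simp [siteToE_apply, abs_of_pos haβ]
      _ ≤ _ := abs_apply_le_norm _ k
  exact (h ⟨q, hq⟩ β hβs L hLs _ hbox hfar).trans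
    ((le_abs_self _).trans (Finset.single_le_sum (fun s _ => abs_nonneg (C s)) (Finset.mem_univ _)))

/-! ## §4 The bit off the hyperplanes -/

/-- **One bit off the hyperplanes (abstract).**  Let `α_k → 0⁺`, `α_k L_k → ∞`, let the lattice kernels `ker_k`
converge to `K` on the mesh points of the off-hyperplane compacts `{η ≤ |α_k z_i| ∀ i, ‖α_k z‖ ≤ 1/η}` and, along a
subsequence `φ`, to `K̃` on the full annuli `{η ≤ ‖α z‖ ≤ 1/η}`, with `K̃` continuous off the origin.  If
`K̃ z₀ ≠ 0` for some `z₀ ≠ 0` then `K ≠ 0` at a point all of whose coordinates are non-zero. [folklore] -/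
theorem bit_offHyperplanes (α : ℕ → ℝ) (L : ℕ → ℕ) (hα : ∀ k, 0 < α k) (hα0 : Tendsto α atTop (𝓝 0))
    (hαL : Tendsto (fun k => α k * L k) atTop atTop) (kerk : ℕ → (Fin 4 → ℤ) → ℝ)
    (K K' : EuclideanSpace ℝ (Fin 4) → ℝ) (φ : ℕ → ℕ) (hφ : StrictMono φ)
    (hΩ : ∀ η ε : ℝ, 0 < η → 0 < ε → ∃ k₀ : ℕ, ∀ k : ℕ, k₀ ≤ k → ∀ z ∈ box 4 (L k),
      (∀ i : Fin 4, η ≤ |α k * (z i : ℝ)|) → ‖α k • siteToE z‖ ≤ η⁻¹ →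
        |kerk k z - K (α k • siteToE z)| ≤ ε)
    (hfull : ∀ η ε : ℝ, 0 < η → 0 < ε → ∃ k₀ : ℕ, ∀ k : ℕ, k₀ ≤ k → ∀ z ∈ box 4 (L (φ k)),
      η ≤ ‖α (φ k) • siteToE z‖ → ‖α (φ k) • siteToE z‖ ≤ η⁻¹ →
        |kerk (φ k) z - K' (α (φ k) • siteToE z)| ≤ ε)
    (hK' : ContinuousOn K' {z | z ≠ 0}) {z₀ : EuclideanSpace ℝ (Fin 4)} (hz₀ : z₀ ≠ 0) (hKz₀ : K' z₀ ≠ 0) :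
    ∃ z : EuclideanSpace ℝ (Fin 4), (∀ i : Fin 4, z i ≠ 0) ∧ K z ≠ 0 := by
  set c := |K' z₀| with hc
  have hc0 : 0 < c := abs_pos.2 hKz₀
  have hca : ContinuousAt K' z₀ := hK'.continuousAt (isOpen_ne.mem_nhds hz₀)
  obtain ⟨δ, hδ, hδK⟩ := Metric.continuousAt_iff.1 hca (c / 4) (by positivity)
  obtain ⟨w, hw, hwi⟩ := exists_near_forall_apply_ne_zero z₀ (half_pos hδ)
  obtain ⟨ρ, hρ, hρw⟩ := exists_pos_forall_le_abs_apply w hwi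
  obtain ⟨δ', hδ', hδ'1, hδ'2⟩ : ∃ δ' : ℝ, 0 < δ' ∧ δ' ≤ δ / 2 ∧ δ' ≤ ρ / 2 :=
    ⟨min (δ / 2) (ρ / 2), lt_min (half_pos hδ) (half_pos hρ), min_le_left _ _, min_le_right _ _⟩
  set R := ‖z₀‖ + δ with hR
  have hR0 : 0 < R + 1 := by positivity
  obtain ⟨η, hη, hη1, hη2⟩ : ∃ η : ℝ, 0 < η ∧ η ≤ ρ / 2 ∧ η ≤ (R + 1)⁻¹ :=
    ⟨min (ρ / 2) (R + 1)⁻¹, lt_min (half_pos hρ) (inv_pos.2 hR0), min_le_left _ _, min_le_right _ _⟩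
  obtain ⟨k₀, hk₀⟩ := hΩ η (c / 4) hη (by positivity)
  obtain ⟨k₁, hk₁⟩ := hfull η (c / 4) hη (by positivity)
  have hsub : Tendsto φ atTop atTop := hφ.tendsto_atTop
  have hmesh := eventually_mesh_near (fun k => α (φ k)) (fun k => L (φ k)) (fun k => hα _)
    (hα0.comp hsub) (hαL.comp hsub) w hδ'
  obtain ⟨k, hk0, hk1, z, hzbox, hzw⟩ :=
    ((eventually_ge_atTop k₀).and ((eventually_ge_atTop k₁).and hmesh)).exists
  set u : EuclideanSpace ℝ (Fin 4) := α (φ k) • siteToE z with hu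
  have hui : ∀ i, u i = α (φ k) * (z i : ℝ) := fun i => by simp [hu, siteToE_apply]
  -- every coordinate of `u` is bounded away from zero
  have hu_i : ∀ i, ρ / 2 ≤ |u i| := by
    intro i
    have h1 : |(u - w) i| ≤ ‖u - w‖ := abs_apply_le_norm _ i
    have h2 : |w i| ≤ |u i| + |(u - w) i| := by
      have : w i = u i - (u - w) i := by simp
      rw [this]
      exact abs_sub _ _
    linarith [hρw i]
  have hη_i : ∀ i : Fin 4, η ≤ |α (φ k) * (z i : ℝ)| := fun i => by
    rw [← hui]; exact hη1.trans (hu_i i)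
  -- `u` lies in the annulus `η ≤ ‖u‖ ≤ 1/η`
  have hdist : dist u z₀ < δ := by
    calc dist u z₀ ≤ dist u w + dist w z₀ := dist_triangle _ _ _
      _ < δ' + δ / 2 := by rw [dist_eq_norm, dist_eq_norm]; exact add_lt_add hzw hw
      _ ≤ δ := by linarith
  have hu_norm : ‖u‖ ≤ η⁻¹ := by
    have h1 : ‖u‖ ≤ ‖u - z₀‖ + ‖z₀‖ := by
      have := norm_add_le (u - z₀) z₀
      rwa [sub_add_cancel] at this
    have h2 : ‖u - z₀‖ < δ := by rwa [dist_eq_norm] at hdist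
    have h3 : R + 1 ≤ η⁻¹ := by
      rw [le_inv_comm₀ hR0 hη]
      exact hη2
    linarith
  have hη_norm : η ≤ ‖u‖ := (hη1.trans (hu_i 0)).trans (abs_apply_le_norm u 0)
  -- the two convergences at the mesh point `z`
  have h1 := hk₀ (φ k) (hk0.trans (hφ.id_le k)) z hzbox hη_i hu_norm
  have h2 := hk₁ k hk1 z hzbox hη_norm hu_norm
  have h4 : dist (K' u) (K' z₀) < c / 4 := hδK hdist
  rw [Real.dist_eq] at h4
  refine ⟨u, fun i h0 => ?_, fun hKu => ?_⟩
  · have := hu_i i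
    rw [h0, abs_zero] at this
    linarith
  · have hKu' : K (α (φ k) • siteToE z) = 0 := hKu
    obtain ⟨h1a, h1b⟩ := abs_le.1 h1
    obtain ⟨h2a, h2b⟩ := abs_le.1 h2
    obtain ⟨h4a, h4b⟩ := abs_lt.1 h4
    have h5 : |K' z₀| ≤ 3 * c / 4 := abs_le.2 ⟨by linarith, by linarith⟩
    linarith

end Summit.QuantumFields.YangMills.Theorems.UniversalDetectorBitOfPlaneTight

/-! ## §5 The item -/

namespace Summit.QuantumFields.YangMills.Theorems

open UniversalDetectorBitOfPlaneTight in
/-- **Item stmt-QuantumFields-24147 (`UniversalDetector.BitOfPlaneTight`).**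
`PlaneTightScheme → SchemeEdgeBit`: `(r, a)`, TIGHT6 and NONCONTACT from `PlaneTightScheme`; EDGE is TIGHT6's
boundedness at the diagonal pairs read at the annulus axis points (`edge_of_bounded`); NONCONTACT_Ω runs the landed
`planeLimitExtraction` on the given admissible sequence, NONCONTACT on the extracted subsequence, and the
mesh/continuity argument `bit_offHyperplanes`.  Glue only; no crux, rung or summit is proved. -/
theorem universalDetector_bitOfPlaneTight_proof :
    Summit.QuantumFields.YangMills.Theses.UniversalDetector.BitOfPlaneTight := by
  unfold Summit.QuantumFields.YangMills.Theses.UniversalDetector.BitOfPlaneTight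
  intro hP
  unfold Summit.QuantumFields.YangMills.Theses.UniversalDetector.SchemeEdgeBit
  intro G _ _ _ _ hG
  letI : MeasurableSpace G := borel G
  haveI : BorelSpace G := ⟨rfl⟩
  obtain ⟨r, a, ha, ha0, hT6, hNC⟩ := hP G hG
  refine ⟨r, a, ha, ha0, ?_⟩
  intro ker ker6
  refine ⟨?_, ?_⟩
  · -- EDGE
    refine edge_of_bounded a ha ker6 fun p q hp hq η hη => ?_
    obtain ⟨C, β₅, Λ₅, ω, -, h⟩ := hT6 p q hp hq η hη
    exact ⟨C, β₅, Λ₅, fun β hβ L hL z hz hzη => (h β hβ L hL z hz hzη).1⟩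
  · -- NONCONTACT_Ω
    intro βs Ls K hβ hL hΩ
    obtain ⟨φ, K', hφ, hconv, hcont, -⟩ :=
      Summit.QuantumFields.YangMills.Cruxes.UniversalDetectorPlaneTight.planeLimitExtraction G hG r a ha ha0
        hT6 βs Ls hβ hL
    have hsub : Tendsto φ atTop atTop := hφ.tendsto_atTop
    obtain ⟨z₀, hz₀, hKz₀⟩ :=
      hNC (fun k => βs (φ k)) (fun k => Ls (φ k)) K' (hβ.comp hsub) (hL.comp hsub) hconv
    exact bit_offHyperplanes (fun k => a (βs k)) Ls (fun k => ha _) (ha0.comp hβ) hL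
      (fun k z => ker (βs k) (Ls k) z) K K' φ hφ hΩ hconv hcont hz₀ hKz₀

end Summit.QuantumFields.YangMills.Theorems

end
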